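import Literature.Probability.Distributions.JointLawTruncatedLimit
import HarnessLib

/-!
# Passing `E[t_k · 1_A(X_k)]` to the limit from joint convergence in law of `(X_k, t_k)` — the glue

Topic `Literature/Probability/Distributions`; second file after `JointLawTruncatedLimit.lean`
(setting and the truncation / second-moment lemmas there).  Random elements `X_k : Ω → E` of a
pseudo-metrizable Borel space, non-negative random reals `t_k`, a finite Borel measure `μ` on `E`,
a measurable `tlim ≥ 0`, and joint convergence in the functional form
`∫ F(X_k, t_k) dP → ∫ F(S, tlim S) dμ` for every bounded continuous `F : E × ℝ → ℝ`.

* `tendsto_integral_min_mul_of_tendsto_pair` — for the TRUNCATED weights `min (t_k) K` and a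
  `μ`-continuity Borel set `A` (`μ (frontier A) = 0`):
  `E[min(t_k, K) 1_A(X_k)] → ∫ min(tlim, K) 1_A dμ` (sandwich `1_A` between Urysohn functions of a
  closed `F ⊆ interior A` and an open `U ⊇ closure A` with `μ (U ∖ F)` small — weak regularity of
  finite Borel measures on pseudo-metrizable spaces, `MeasurableSet.exists_isClosed_lt_add` /
  `Set.exists_isOpen_lt_add`, and Urysohn `exists_continuous_zero_one_of_isClosed`);
* `tendsto_integral_mul_indicator_of_tendsto_pair` — **the glue** (node (D) of the census of the
  limit-passage stub of crux `FlipErgodicityZ2`, route CardyMeckeFlip, but model-free): under the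
  uniform second-moment bound `E[t_k²] ≤ C` the truncation costs at most `C/K` on both sides,
  hence `E[t_k 1_A(X_k)] → ∫ tlim · 1_A dμ`.

No named fact; Mathlib only.

## References

* P. Billingsley, *Convergence of Probability Measures*, 2nd ed. (1999), Thm. 2.1 (portmanteau)
  and Thm. 3.5 (uniform integrability and convergence of moments).
-/

noncomputable section

open Set Filter
open _root_.MeasureTheory _root_.Topology
open scoped ENNReal

namespace Literature.Probability.Distributions

section Glue

variable {Ω E : Type*} [MeasurableSpace Ω] {P : Measure Ω}
  [TopologicalSpace E] [MeasurableSpace E] {μ : Measure E}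

/-! ### The truncated weights: a portmanteau sandwich -/

/-- **Truncated glue.**  Joint convergence `∫ F(X_k, t_k) dP → ∫ F(S, tlim S) dμ` for bounded
continuous `F`, with `t_k, tlim ≥ 0`, gives for every `K > 0` and every Borel `μ`-continuity set
`A` (`μ (frontier A) = 0`):  `E[min(t_k, K) · 1_A(X_k)] → ∫ min(tlim, K) · 1_A dμ`.
Proof: sandwich `1_A` between Urysohn functions `g₁ ≤ 1_A ≤ g₂` attached to a closed
`F ⊆ interior A` and an open `U ⊇ closure A` with `μ (U ∖ F)` small (weak regularity of `μ` and
`μ (closure A ∖ interior A) = 0`); the outer integrals converge by hypothesis. [folklore] -/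
theorem tendsto_integral_min_mul_of_tendsto_pair [TopologicalSpace.PseudoMetrizableSpace E]
    [BorelSpace E] [IsFiniteMeasure P] [IsFiniteMeasure μ]
    {X : ℕ → Ω → E} {t : ℕ → Ω → ℝ} {tlim : E → ℝ}
    (hX : ∀ k, Measurable (X k)) (ht : ∀ k, Measurable (t k)) (htlim : Measurable tlim)
    (ht0 : ∀ k ω, 0 ≤ t k ω) (htlim0 : ∀ S, 0 ≤ tlim S)
    (hconv : ∀ F : BoundedContinuousFunction (E × ℝ) ℝ,
      Tendsto (fun k => ∫ ω, F (X k ω, t k ω) ∂P) atTop (𝓝 (∫ S, F (S, tlim S) ∂μ)))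
    {K : ℝ} (hK : 0 < K) {A : Set E} (hA : MeasurableSet A) (hA0 : μ (frontier A) = 0) :
    Tendsto (fun k => ∫ ω, min (t k ω) K * A.indicator 1 (X k ω) ∂P) atTop
      (𝓝 (∫ S, min (tlim S) K * A.indicator 1 S ∂μ)) := by
  rw [Metric.tendsto_atTop]
  intro η hη
  -- regularity: closed `F ⊆ interior A`, open `U ⊇ closure A`, `μ`-close
  have hδpos : (0 : ℝ≥0∞) < ENNReal.ofReal (η / (8 * K)) := ENNReal.ofReal_pos.2 (by positivity)
  have hmint : MeasurableSet (interior A) := isOpen_interior.measurableSet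
  obtain ⟨F, hFA, hFc, hF⟩ := hmint.exists_isClosed_lt_add (measure_ne_top μ _) hδpos.ne'
  obtain ⟨U, hUA, hUo, hU⟩ := (closure A).exists_isOpen_lt_add (measure_ne_top μ _) hδpos.ne'
  -- Urysohn functions
  obtain ⟨g₁, hg₁0, hg₁1, hg₁⟩ := exists_continuous_zero_one_of_isClosed
    (isOpen_interior (s := A)).isClosed_compl hFc (disjoint_compl_left_iff_subset.2 hFA)
  obtain ⟨g₂, hg₂0, hg₂1, hg₂⟩ := exists_continuous_zero_one_of_isClosed hUo.isClosed_compl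
    isClosed_closure (disjoint_compl_left_iff_subset.2 hUA)
  -- as bounded continuous functions
  have hbd : ∀ (g : C(E, ℝ)), (∀ x, g x ∈ Icc (0 : ℝ) 1) → ∀ x y : E, dist (g x) (g y) ≤ 1 :=
    fun g hg x y => by
      rw [Real.dist_eq, abs_sub_le_iff]
      constructor <;> linarith [(hg x).1, (hg x).2, (hg y).1, (hg y).2]
  set b₁ : BoundedContinuousFunction E ℝ := BoundedContinuousFunction.mkOfBound g₁ 1 (hbd g₁ hg₁)
    with hb₁
  set b₂ : BoundedContinuousFunction E ℝ := BoundedContinuousFunction.mkOfBound g₂ 1 (hbd g₂ hg₂)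
    with hb₂
  have hb₁g : ∀ S, b₁ S = g₁ S := fun S => rfl
  have hb₂g : ∀ S, b₂ S = g₂ S := fun S => rfl
  -- pointwise sandwich `g₁ ≤ 1_A ≤ g₂` and `g₂ - g₁ ≤ 1_{U \ F}`
  have hind01 : ∀ S, A.indicator (1 : E → ℝ) S ∈ Icc (0 : ℝ) 1 := indicator_one_mem_Icc A
  have hUF01 : ∀ S, (U \ F).indicator (1 : E → ℝ) S ∈ Icc (0 : ℝ) 1 :=
    indicator_one_mem_Icc (U \ F)
  have hlow : ∀ S, g₁ S ≤ A.indicator (1 : E → ℝ) S := fun S => by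
    by_cases hS : S ∈ interior A
    · rw [indicator_of_mem (interior_subset hS), Pi.one_apply]; exact (hg₁ S).2
    · rw [show g₁ S = 0 from hg₁0 hS]; exact (hind01 S).1
  have hupp : ∀ S, A.indicator (1 : E → ℝ) S ≤ g₂ S := fun S => by
    by_cases hS : S ∈ A
    · rw [indicator_of_mem hS, Pi.one_apply, show g₂ S = 1 from hg₂1 (subset_closure hS)]
    · rw [indicator_of_notMem hS]; exact (hg₂ S).1
  have hdiff : ∀ S, g₂ S - g₁ S ≤ (U \ F).indicator (1 : E → ℝ) S := fun S => by
    have h01 := hUF01 S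
    by_cases hSU : S ∈ U
    · by_cases hSF : S ∈ F
      · have h1 : g₁ S = 1 := hg₁1 hSF
        linarith [(hg₂ S).2, h01.1]
      · have hmem : S ∈ U \ F := ⟨hSU, hSF⟩
        rw [indicator_of_mem hmem, Pi.one_apply]
        linarith [(hg₂ S).2, (hg₁ S).1]
    · have h2 : g₂ S = 0 := hg₂0 hSU
      linarith [(hg₁ S).1, h01.1]
  -- `μ (U \ F)` is small: `U \ F ⊆ (U \ closure A) ∪ frontier A ∪ (interior A \ F)`
  have hUF : μ (U \ F) ≤ ENNReal.ofReal (η / (8 * K)) + ENNReal.ofReal (η / (8 * K)) := by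
    have hsub : U \ F ⊆ (U \ closure A) ∪ (frontier A ∪ (interior A \ F)) := by
      intro S hS
      obtain ⟨hSU, hSF⟩ := hS
      by_cases h1 : S ∈ closure A
      · by_cases h2 : S ∈ interior A
        · exact Or.inr (Or.inr ⟨h2, hSF⟩)
        · exact Or.inr (Or.inl ⟨h1, h2⟩)
      · exact Or.inl ⟨hSU, h1⟩
    have h1 : μ (U \ closure A) ≤ ENNReal.ofReal (η / (8 * K)) :=
      (measure_sdiff_lt_of_lt_add isClosed_closure.nullMeasurableSet hUA
        (measure_ne_top μ _) hU).le
    have h3 : μ (interior A \ F) ≤ ENNReal.ofReal (η / (8 * K)) :=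
      (measure_sdiff_lt_of_lt_add hFc.nullMeasurableSet hFA (measure_ne_top μ _) hF).le
    calc μ (U \ F) ≤ μ (U \ closure A) + (μ (frontier A) + μ (interior A \ F)) :=
          (measure_mono hsub).trans ((measure_union_le _ _).trans
            (add_le_add le_rfl (measure_union_le _ _)))
      _ ≤ _ := by rw [hA0, zero_add]; exact add_le_add h1 h3
  have hUFreal : μ.real (U \ F) ≤ η / (4 * K) := by
    have hne : ENNReal.ofReal (η / (8 * K)) + ENNReal.ofReal (η / (8 * K)) ≠ ⊤ := by simp
    have h := ENNReal.toReal_mono hne hUF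
    rw [ENNReal.toReal_add ENNReal.ofReal_ne_top ENNReal.ofReal_ne_top,
      ENNReal.toReal_ofReal (by positivity)] at h
    have h8 : η / (8 * K) + η / (8 * K) = η / (4 * K) := by ring
    rw [measureReal_def]
    linarith
  -- test functions for the joint convergence
  obtain ⟨F₁, hF₁⟩ := exists_bcf_mul_clamp b₁ (fun S => hg₁ S) hK
  obtain ⟨F₂, hF₂⟩ := exists_bcf_mul_clamp b₂ (fun S => hg₂ S) hK
  have hc₁ := hconv F₁
  have hc₂ := hconv F₂
  -- integrability facts (everything is bounded by `K`)
  have hclamp_lim : ∀ S, max 0 (min (tlim S) K) = min (tlim S) K := fun S =>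
    max_eq_right (le_min (htlim0 S) hK.le)
  have hclamp : ∀ k ω, max 0 (min (t k ω) K) = min (t k ω) K := fun k ω =>
    max_eq_right (le_min (ht0 k ω) hK.le)
  have hmink : Measurable fun S => min (tlim S) K := htlim.min measurable_const
  have hmink' : ∀ k, Measurable fun ω => min (t k ω) K := fun k => (ht k).min measurable_const
  have hmin0 : ∀ S, 0 ≤ min (tlim S) K := fun S => le_min (htlim0 S) hK.le
  have hmin0' : ∀ k ω, 0 ≤ min (t k ω) K := fun k ω => le_min (ht0 k ω) hK.le
  have hint_ind : Integrable (fun S => min (tlim S) K * A.indicator 1 S) μ :=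
    integrable_mul_of_le_of_mem_Icc hmink (measurable_const.indicator hA) hmin0
      (fun S => min_le_right _ _) hind01
  have hint_g : ∀ (g : C(E, ℝ)), (∀ S, g S ∈ Icc (0 : ℝ) 1) →
      Integrable (fun S => min (tlim S) K * g S) μ := fun g hg =>
    integrable_mul_of_le_of_mem_Icc hmink g.continuous.measurable hmin0
      (fun S => min_le_right _ _) hg
  have hint_UF : Integrable (fun S => min (tlim S) K * (U \ F).indicator 1 S) μ :=
    integrable_mul_of_le_of_mem_Icc hmink
      (measurable_const.indicator (hUo.measurableSet.diff hFc.measurableSet)) hmin0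
      (fun S => min_le_right _ _) hUF01
  have hint_a : ∀ k, Integrable (fun ω => min (t k ω) K * A.indicator 1 (X k ω)) P := fun k =>
    integrable_mul_of_le_of_mem_Icc (hmink' k) ((measurable_const.indicator hA).comp (hX k))
      (hmin0' k) (fun ω => min_le_right _ _) (fun ω => hind01 _)
  have hint_f : ∀ (g : C(E, ℝ)), (∀ S, g S ∈ Icc (0 : ℝ) 1) → ∀ k,
      Integrable (fun ω => min (t k ω) K * g (X k ω)) P := fun g hg k =>
    integrable_mul_of_le_of_mem_Icc (hmink' k) (g.continuous.measurable.comp (hX k)) (hmin0' k)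
      (fun ω => min_le_right _ _) (fun ω => hg _)
  -- abbreviations for the limits; `L₁ ≤ L ≤ L₂ ≤ L₁ + η/4`
  set L : ℝ := ∫ S, min (tlim S) K * A.indicator 1 S ∂μ with hL
  have hL₁eq : ∫ S, F₁ (S, tlim S) ∂μ = ∫ S, min (tlim S) K * g₁ S ∂μ :=
    integral_congr_ae (Eventually.of_forall fun S => by
      show F₁ (S, tlim S) = min (tlim S) K * g₁ S
      rw [hF₁, hb₁g, hclamp_lim, mul_comm])
  have hL₂eq : ∫ S, F₂ (S, tlim S) ∂μ = ∫ S, min (tlim S) K * g₂ S ∂μ :=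
    integral_congr_ae (Eventually.of_forall fun S => by
      show F₂ (S, tlim S) = min (tlim S) K * g₂ S
      rw [hF₂, hb₂g, hclamp_lim, mul_comm])
  have hL₁L : ∫ S, F₁ (S, tlim S) ∂μ ≤ L := by
    rw [hL₁eq]
    exact integral_mono (hint_g g₁ hg₁) hint_ind fun S =>
      mul_le_mul_of_nonneg_left (hlow S) (hmin0 S)
  have hLL₂ : L ≤ ∫ S, F₂ (S, tlim S) ∂μ := by
    rw [hL₂eq]
    exact integral_mono hint_ind (hint_g g₂ hg₂) fun S =>
      mul_le_mul_of_nonneg_left (hupp S) (hmin0 S)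
  have hUFm : MeasurableSet (U \ F) := hUo.measurableSet.diff hFc.measurableSet
  have hL₂L₁ : ∫ S, F₂ (S, tlim S) ∂μ - ∫ S, F₁ (S, tlim S) ∂μ ≤ η / 4 := by
    rw [hL₁eq, hL₂eq, ← integral_sub (hint_g g₂ hg₂) (hint_g g₁ hg₁)]
    have hint_KUF : Integrable (fun S => K * (U \ F).indicator 1 S) μ :=
      ((integrable_const (1 : ℝ)).indicator hUFm).const_mul K
    calc ∫ S, (min (tlim S) K * g₂ S - min (tlim S) K * g₁ S) ∂μ
        ≤ ∫ S, min (tlim S) K * (U \ F).indicator 1 S ∂μ := by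
          refine integral_mono ((hint_g g₂ hg₂).sub (hint_g g₁ hg₁)) hint_UF fun S => ?_
          show min (tlim S) K * g₂ S - min (tlim S) K * g₁ S ≤ _
          rw [← mul_sub]
          exact mul_le_mul_of_nonneg_left (hdiff S) (hmin0 S)
      _ ≤ ∫ S, K * (U \ F).indicator 1 S ∂μ := by
          refine integral_mono hint_UF hint_KUF fun S => ?_
          exact mul_le_mul_of_nonneg_right (min_le_right _ _) (hUF01 S).1
      _ = K * μ.real (U \ F) := by
          rw [integral_const_mul, integral_indicator_one hUFm]
      _ ≤ K * (η / (4 * K)) := mul_le_mul_of_nonneg_left hUFreal hK.le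
      _ = η / 4 := by field_simp
  -- the lattice side: the truncated Campbell integrals are sandwiched by `∫ F₁`, `∫ F₂`
  have hf₁eq : ∀ k, ∫ ω, F₁ (X k ω, t k ω) ∂P = ∫ ω, min (t k ω) K * g₁ (X k ω) ∂P := fun k =>
    integral_congr_ae (Eventually.of_forall fun ω => by
      show F₁ (X k ω, t k ω) = min (t k ω) K * g₁ (X k ω)
      rw [hF₁, hb₁g, hclamp, mul_comm])
  have hf₂eq : ∀ k, ∫ ω, F₂ (X k ω, t k ω) ∂P = ∫ ω, min (t k ω) K * g₂ (X k ω) ∂P := fun k =>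
    integral_congr_ae (Eventually.of_forall fun ω => by
      show F₂ (X k ω, t k ω) = min (t k ω) K * g₂ (X k ω)
      rw [hF₂, hb₂g, hclamp, mul_comm])
  have hlow_k : ∀ k, ∫ ω, F₁ (X k ω, t k ω) ∂P ≤ ∫ ω, min (t k ω) K * A.indicator 1 (X k ω) ∂P :=
    fun k => by
      rw [hf₁eq]
      exact integral_mono (hint_f g₁ hg₁ k) (hint_a k) fun ω =>
        mul_le_mul_of_nonneg_left (hlow _) (hmin0' k ω)
  have hupp_k : ∀ k, ∫ ω, min (t k ω) K * A.indicator 1 (X k ω) ∂P ≤ ∫ ω, F₂ (X k ω, t k ω) ∂P :=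
    fun k => by
      rw [hf₂eq]
      exact integral_mono (hint_a k) (hint_f g₂ hg₂ k) fun ω =>
        mul_le_mul_of_nonneg_left (hupp _) (hmin0' k ω)
  -- eventually both test integrals are `η/4`-close to their limits
  have hη4 : (0 : ℝ) < η / 4 := by positivity
  obtain ⟨N₁, hN₁⟩ := (Metric.tendsto_atTop.1 hc₁) (η / 4) hη4
  obtain ⟨N₂, hN₂⟩ := (Metric.tendsto_atTop.1 hc₂) (η / 4) hη4
  refine ⟨max N₁ N₂, fun k hk => ?_⟩
  have h₁ := hN₁ k (le_of_max_le_left hk)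
  have h₂ := hN₂ k (le_of_max_le_right hk)
  rw [Real.dist_eq, abs_sub_lt_iff] at h₁ h₂ ⊢
  have hl := hlow_k k
  have hu := hupp_k k
  constructor <;> linarith [h₁.1, h₁.2, h₂.1, h₂.2]

/-! ### The glue: removing the truncation with the second-moment bound -/

/-- **The glue (node (D)).**  Let `(X_k, t_k)` converge jointly in law to `(S, tlim S)`, `S ∼ μ`, in
the functional form `∫ F(X_k, t_k) dP → ∫ F(S, tlim S) dμ` for all bounded continuous `F`, with
`t_k, tlim ≥ 0` measurable and the uniform second-moment bound `E[t_k²] ≤ C`.  Then for every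
Borel `μ`-continuity set `A`, `E[t_k · 1_A(X_k)] → ∫ tlim · 1_A dμ`: truncate at level `K`
(cost `≤ C/K` on both sides, since `t - min t K ≤ t²/K` and `∫ tlim² dμ ≤ C` by
`integrable_sq_of_tendsto_pair`), and apply `tendsto_integral_min_mul_of_tendsto_pair`.
[folklore] -/
theorem tendsto_integral_mul_indicator_of_tendsto_pair [TopologicalSpace.PseudoMetrizableSpace E]
    [BorelSpace E] [IsFiniteMeasure P] [IsFiniteMeasure μ]
    {X : ℕ → Ω → E} {t : ℕ → Ω → ℝ} {tlim : E → ℝ}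
    (hX : ∀ k, Measurable (X k)) (ht : ∀ k, Measurable (t k)) (htlim : Measurable tlim)
    (ht0 : ∀ k ω, 0 ≤ t k ω) (htlim0 : ∀ S, 0 ≤ tlim S)
    (hconv : ∀ F : BoundedContinuousFunction (E × ℝ) ℝ,
      Tendsto (fun k => ∫ ω, F (X k ω, t k ω) ∂P) atTop (𝓝 (∫ S, F (S, tlim S) ∂μ)))
    (hti : ∀ k, Integrable (t k) P) (hint : ∀ k, Integrable (fun ω => t k ω ^ 2) P) {C : ℝ}
    (hC : ∀ k, ∫ ω, t k ω ^ 2 ∂P ≤ C) {A : Set E} (hA : MeasurableSet A)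
    (hA0 : μ (frontier A) = 0) :
    Tendsto (fun k => ∫ ω, t k ω * A.indicator 1 (X k ω) ∂P) atTop
      (𝓝 (∫ S, tlim S * A.indicator 1 S ∂μ)) := by
  obtain ⟨hsq, hsqC, htli⟩ := integrable_sq_of_tendsto_pair htlim ht0 htlim0 hconv hint hC
  have hC0 : 0 ≤ C := le_trans (integral_nonneg fun ω => sq_nonneg _) (hC 0)
  rw [Metric.tendsto_atTop]
  intro η hη
  -- choose the truncation level with `C / K ≤ η / 4`
  set K : ℝ := 4 * C / η + 1 with hKdef
  have hK : 0 < K := by positivity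
  have hCK : C / K ≤ η / 4 := by
    rw [div_le_iff₀ hK]
    have : η / 4 * K = C + η / 4 := by rw [hKdef]; field_simp
    linarith
  have hind01 : ∀ S, A.indicator (1 : E → ℝ) S ∈ Icc (0 : ℝ) 1 := indicator_one_mem_Icc A
  -- truncation on the lattice side and on the limit side
  have hlat : ∀ k, |∫ ω, t k ω * A.indicator 1 (X k ω) ∂P -
      ∫ ω, min (t k ω) K * A.indicator 1 (X k ω) ∂P| ≤ η / 4 := fun k => by
    have h := abs_integral_mul_sub_integral_min_mul_le P (ht k)
      ((measurable_const.indicator hA).comp (hX k)) (ht0 k) (fun ω => hind01 (X k ω)) (hti k)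
      (hint k) hK
    exact h.trans (((div_le_div_iff_of_pos_right hK).2 (hC k)).trans hCK)
  have hlimtr : |∫ S, tlim S * A.indicator 1 S ∂μ - ∫ S, min (tlim S) K * A.indicator 1 S ∂μ|
      ≤ η / 4 := by
    have h := abs_integral_mul_sub_integral_min_mul_le μ htlim (measurable_const.indicator hA)
      htlim0 hind01 htli hsq hK
    exact h.trans (((div_le_div_iff_of_pos_right hK).2 hsqC).trans hCK)
  -- the truncated integrals converge
  have hK' := tendsto_integral_min_mul_of_tendsto_pair hX ht htlim ht0 htlim0 hconv hK hA hA0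
  obtain ⟨N, hN⟩ := (Metric.tendsto_atTop.1 hK') (η / 4) (by positivity)
  refine ⟨N, fun k hk => ?_⟩
  have h := hN k hk
  rw [Real.dist_eq] at h ⊢
  have hl := hlat k
  rw [abs_sub_le_iff] at hl hlimtr
  rw [abs_sub_lt_iff] at h ⊢
  constructor <;> linarith [hl.1, hl.2, hlimtr.1, hlimtr.2, h.1, h.2]

end Glue

end Literature.Probability.Distributions

end
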